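import Summits.NavierStokesRegularity.NavierStokesRegularity.Theses.SwallowedContinuum
import Literature.Analysis.FluidPDE.SuitableWeak
import HarnessLib.Audit

/-!
# Birth skeleton (BC3) of the crux `SwallowedContinuum.NoDiscFreeCollapse`

Crux item `stmt-NavierStokesRegularity-17613` (decl
`Summit.NavierStokesRegularity.NavierStokesRegularity.Theses.SwallowedContinuum.NoDiscFreeCollapse`,
crux rank 3 of route `route-NavierStokesRegularity-SwallowedContinuum`, re-audit bin HONEST). Tree path
`Cruxes/NoDiscFreeCollapse/Lines/birth.lean`; registrar `planner-skel-stmt-NavierStokesRegularity-17613-0`,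
2026-08-17. Nothing here is new mathematics: it types the route's OWN declared layer-2 cut of the crux
(route header, TWO-LAYER PLAN: "each sector K ⇐ K_TypeI → K_notTypeI → K, split by the in-tree rate
predicate `IsTypeIBlowup u T`"; the opening planner's unpublished evidence skeleton
`NoDiscFreeCollapse_birth_pub.lean` had exactly the two rate stubs) as a REGISTERED skeleton, sharpened by
the route's own localisation step (support item `RegularFibreTrivial`, stmt-NavierStokesRegularity-17617:
"nondegenerate swallowed sets sit only over singular points").

THE CRUX. For every `ν > 0`, `T > 0`, every classical solution `(u,p)` of unforced Navier–Stokes on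
`ℝ³ × [0,T)` that is Leray–Hopf on `[0,T]` from the rapidly decaying datum `u 0`, every flow map `X` of `u`
on `[0,T)` (`X 0 a = a`, `∂ₛ X s a = u s (X s a)` within `[0,T)`) and every uniform limit `Xs` of `X t`
as `t ↑ T`: every NONDEGENERATE fibre `Xs ⁻¹' {x}` (not a subsingleton: at least two labels swallowed
into `x`) contains an embedded closed 2-disc (the image of the closed unit disc of `ℝ²` under a map
continuous and injective on it) — a first singularity never swallows only a disc-free continuum.

THE CUT (three named stubs; the composition `NoDiscFreeCollapse_of` is pure logic, kernel-checked):

* `stub_regularFibreTrivial : SwallowedContinuum.RegularFibreTrivial` — twin BY NAME of the route's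
  support item `stmt-NavierStokesRegularity-17617` (grounded provable-now: interior regularity gives a
  field Lipschitz up to `T` near a point `x` over which `u` stays bounded from below,
  `∃ r > 0, ∃ M, ‖u t y‖ ≤ M` on `[T - r², T) × B(x, r)`; backward ODE uniqueness through the common
  endpoint makes the fibre `Xs ⁻¹' {x}` a subsingleton). A proof of item 17617 discharges this stub by
  `exact`. ROLE: localisation — a nondegenerate fibre sits over a point `x` that is SINGULAR FROM BELOW
  (the negation of the local bound), which the two sector stubs then receive as a hypothesis.
* `stub_typeI_singularFibreHasDisc` (OPEN, the Type-I sector `K_TypeI`): the crux's conclusion for a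
  nondegenerate fibre over a singular-from-below point `x` when the blow-up at `T` is of Type I in the
  tree's sense, `IsTypeIBlowup u T : ∃ C, ∀ᶠ t in 𝓝[<] T, ∀ x, ‖u t x‖ ≤ C / √(T - t)` (Leray rate).
  Reading (route header): in a converging Leray similarity frame at `(x, T)` the swallowed set is the
  bounded-forward-orbit set of `ẏ = U(y, s) + y/2`, `div = 3/2`, so "disc-free nondegenerate fibre"
  means a Type-I tangent flow with a bounded invariant set whose stable set is one-dimensional — a
  Liouville statement about the stagnation structure of Type-I profiles. Why it might fail: a Type-I
  profile with an axial (one contracting direction) collapse; DSS frames need not converge.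
* `stub_notTypeI_singularFibreHasDisc` (OPEN, the complementary sector `K_notTypeI`): the same with
  `¬ IsTypeIBlowup u T` (genuinely Type II at `T`: the rate `C/√(T-t)` fails for every `C`). Why it
  might fail (route card K2): axial-strain / sheet-forming collapses (Elgindi-type `C^{1,α}` Euler
  blow-up crushes a material axis segment; antiparallel and iterated-sheet scenarios) are arc-type and
  Type II; vortex-layer zoom limits are unstable rather than provably harmless.

`NoDiscFreeCollapse_of : NoDiscFreeCollapse` is the ONLY theorem of this file concluding the crux (by
name, no `Prop` hypotheses; `sorry` only inside the three `stub_*`, which it uses by name): given a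
nondegenerate fibre over `x`, `stub_regularFibreTrivial` forbids the local bound at `x` (else the fibre
is a subsingleton), and `by_cases IsTypeIBlowup u T` dispatches to the two sector stubs.

HONEST NOTE ON THE SEAM. The seam is a case split (rate dichotomy) behind a localisation lemma, not an
analytic identity: all the open content sits in the two sector stubs, each strictly weaker than the
crux (extra hypotheses: the rate regime and the singular point), neither cheaply the crux or the
summit — BC3 probes (registrar folder `bc/probe_*.lean`, raw outputs in `Lines/birth.md`): for each
stub `S`, `S → NoDiscFreeCollapse` and `S → NavierStokesRegularity` by
`first | exact? | simpa using h | aesop` FAIL. The localisation stub is a filed support item of the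
route (provable now), not bookkeeping invented here.

Disproof used: none exists for this crux (`ledger crux ls stmt-NavierStokesRegularity-17613`: no
workfiles before this one). The sibling crux's `Cruxes/NoDiscSwallow/Disproof.lean` (birth attack on
`NoDiscSwallow`, 2026-08-17) records that every flow-map clause and the NS / Leray–Hopf / decay
hypotheses are load-bearing for fibre statements of this shape (`noDiscSwallow_false_without_ode /
_init / _limit / _NS`): all of them are carried VERBATIM into both sector stubs here (nothing dropped),
and the rest state (`Xs = id`, all fibres singletons) satisfies the crux vacuously. Negatives index
consulted (`ledger negatives --problem NavierStokesRegularity`): no refuted statement of the summit is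
an instance of any stub.
-/

namespace Summit.NavierStokesRegularity.NavierStokesRegularity.Cruxes.NoDiscFreeCollapse.Birth

set_option linter.dupNamespace false
set_option linter.unusedVariables false

open Summit.NavierStokesRegularity.NavierStokesRegularity.Theses.SwallowedContinuum

/-- **stub 1 — `stub_regularFibreTrivial` (M, PROVABLE NOW; twin by name of route support item
`stmt-NavierStokesRegularity-17617`, `SwallowedContinuum.RegularFibreTrivial`).** Over a point `x` near
which `u` stays bounded up to `T` from below, the fibre `Xs ⁻¹' {x}` of the endpoint map has at most one
label (interior regularity ⇒ locally Lipschitz field up to `T`; backward ODE uniqueness through the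
common endpoint). [cite: doi:10.1088/0951-7715/22/9/002; CaffarelliKohnNirenberg1982; LemarieRieusset2016] -/
theorem stub_regularFibreTrivial :
    Summit.NavierStokesRegularity.NavierStokesRegularity.Theses.SwallowedContinuum.RegularFibreTrivial := by
  sorry

/-- **stub 2 — `stub_typeI_singularFibreHasDisc` (XL, OPEN; the Type-I sector of the crux).** Same
hypotheses as the crux, plus the Leray Type-I rate `IsTypeIBlowup u T` and a point `x` singular from
below (`u` unbounded on every `[T - r², T) × B(x, r)`): a nondegenerate fibre `Xs ⁻¹' {x}` contains an
embedded closed 2-disc. [cite: KNSS2009; SereginSverak2009; Tao2011, Prop. 9.1] -/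
theorem stub_typeI_singularFibreHasDisc :
    ∀ (ν T : ℝ), 0 < ν → 0 < T →
      ∀ (u : ℝ → EuclideanSpace ℝ (Fin 3) → EuclideanSpace ℝ (Fin 3)) (p : ℝ → EuclideanSpace ℝ (Fin 3) → ℝ),
        Literature.Analysis.FluidPDE.IsClassicalNSSolutionOn (Set.Ico 0 T) ν 0 u p →
        Literature.Analysis.FluidPDE.IsLerayHopfOn T ν 0 (u 0) u →
        Literature.Analysis.FluidPDE.HasRapidSpatialDecay (u 0) →
        Literature.Analysis.FluidPDE.IsTypeIBlowup u T →
        ∀ (X : ℝ → EuclideanSpace ℝ (Fin 3) → EuclideanSpace ℝ (Fin 3))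
          (Xs : EuclideanSpace ℝ (Fin 3) → EuclideanSpace ℝ (Fin 3)),
          (∀ a, X 0 a = a) →
          (∀ a, ∀ t ∈ Set.Ico 0 T, HasDerivWithinAt (fun s => X s a) (u t (X t a)) (Set.Ico 0 T) t) →
          TendstoUniformly X Xs (nhdsWithin T (Set.Iio T)) →
          ∀ x : EuclideanSpace ℝ (Fin 3),
            (¬ ∃ r > 0, ∃ M : ℝ, ∀ t ∈ Set.Ico (T - r ^ 2) T, ∀ y ∈ Metric.ball x r, ‖u t y‖ ≤ M) →
            ¬ (Xs ⁻¹' {x}).Subsingleton →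
            ∃ φ : EuclideanSpace ℝ (Fin 2) → EuclideanSpace ℝ (Fin 3),
              ContinuousOn φ (Metric.closedBall 0 1) ∧ Set.InjOn φ (Metric.closedBall 0 1) ∧
                Set.MapsTo φ (Metric.closedBall 0 1) (Xs ⁻¹' {x}) := by
  sorry

/-- **stub 3 — `stub_notTypeI_singularFibreHasDisc` (XL, OPEN; the complementary, Type-II sector).**
Same hypotheses as the crux, plus `¬ IsTypeIBlowup u T` (the Leray rate fails for every constant) and a
point `x` singular from below: a nondegenerate fibre `Xs ⁻¹' {x}` contains an embedded closed 2-disc.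
[cite: Elgindi2021; doi:10.1007/s00205-019-01419-1; BrennerHormozPumir2016; ChenHou2022; Tao2011] -/
theorem stub_notTypeI_singularFibreHasDisc :
    ∀ (ν T : ℝ), 0 < ν → 0 < T →
      ∀ (u : ℝ → EuclideanSpace ℝ (Fin 3) → EuclideanSpace ℝ (Fin 3)) (p : ℝ → EuclideanSpace ℝ (Fin 3) → ℝ),
        Literature.Analysis.FluidPDE.IsClassicalNSSolutionOn (Set.Ico 0 T) ν 0 u p →
        Literature.Analysis.FluidPDE.IsLerayHopfOn T ν 0 (u 0) u →
        Literature.Analysis.FluidPDE.HasRapidSpatialDecay (u 0) →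
        ¬ Literature.Analysis.FluidPDE.IsTypeIBlowup u T →
        ∀ (X : ℝ → EuclideanSpace ℝ (Fin 3) → EuclideanSpace ℝ (Fin 3))
          (Xs : EuclideanSpace ℝ (Fin 3) → EuclideanSpace ℝ (Fin 3)),
          (∀ a, X 0 a = a) →
          (∀ a, ∀ t ∈ Set.Ico 0 T, HasDerivWithinAt (fun s => X s a) (u t (X t a)) (Set.Ico 0 T) t) →
          TendstoUniformly X Xs (nhdsWithin T (Set.Iio T)) →
          ∀ x : EuclideanSpace ℝ (Fin 3),
            (¬ ∃ r > 0, ∃ M : ℝ, ∀ t ∈ Set.Ico (T - r ^ 2) T, ∀ y ∈ Metric.ball x r, ‖u t y‖ ≤ M) →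
            ¬ (Xs ⁻¹' {x}).Subsingleton →
            ∃ φ : EuclideanSpace ℝ (Fin 2) → EuclideanSpace ℝ (Fin 3),
              ContinuousOn φ (Metric.closedBall 0 1) ∧ Set.InjOn φ (Metric.closedBall 0 1) ∧
                Set.MapsTo φ (Metric.closedBall 0 1) (Xs ⁻¹' {x}) := by
  sorry

/-- **Birth composition (the skeleton theorem).** The crux BY NAME from the three registered stubs,
used by name: localise the nondegenerate fibre over a singular-from-below point with
`stub_regularFibreTrivial` (contrapositive), then split on the rate `IsTypeIBlowup u T`. Pure logic. -/
theorem NoDiscFreeCollapse_of :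
    Summit.NavierStokesRegularity.NavierStokesRegularity.Theses.SwallowedContinuum.NoDiscFreeCollapse := by
  intro ν T hν hT u p hcl hLH hdec X Xs h0 hode hlim x hns
  have hsing : ¬ ∃ r > 0, ∃ M : ℝ, ∀ t ∈ Set.Ico (T - r ^ 2) T, ∀ y ∈ Metric.ball x r, ‖u t y‖ ≤ M :=
    fun hreg => hns (stub_regularFibreTrivial ν T hν hT u p hcl hLH hdec X Xs h0 hode hlim x hreg)
  by_cases hI : Literature.Analysis.FluidPDE.IsTypeIBlowup u T
  · exact stub_typeI_singularFibreHasDisc ν T hν hT u p hcl hLH hdec hI X Xs h0 hode hlim x hsing hns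
  · exact stub_notTypeI_singularFibreHasDisc ν T hν hT u p hcl hLH hdec hI X Xs h0 hode hlim x hsing hns

end Summit.NavierStokesRegularity.NavierStokesRegularity.Cruxes.NoDiscFreeCollapse.Birth
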